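import Literature.Combinatorics.SimpleGraph.GraphDivisors
import Literature.Combinatorics.SimpleGraph.ChipFiringBounds
import Mathlib.Combinatorics.SimpleGraph.Metric
import Mathlib.Data.Int.LeastGreatest
import HarnessLib

/-!
# Reduced divisors: every divisor on a connected graph is linearly equivalent to a unique
# `v₀`-reduced divisor (Baker–Norine 2007, Proposition 3.1)

Source (held, read at the page; statements VERBATIM). M. Baker, S. Norine, *Riemann–Roch and
Abel–Jacobi theory on a finite graph*, Adv. Math. 215 (2007) 766–788 [BakerNorine2007], §3.1
«`G`-parking functions and reduced divisors» (held text `paper:doi-10-1016-j-aim-2007-04-012`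
pp. 12–14): «For `A ⊆ V(G)` and `v ∈ A`, let `outdeg_A(v)` denote the number of edges of `G`
having `v` as one endpoint and whose other endpoint lies in `V(G) − A`. Select a vertex
`v₀ ∈ V(G)`. We say that a function `f : V(G) − {v₀} → ℤ` is a `G`-parking function (relative to
the base vertex `v₀`) if the following two conditions are satisfied: (P1) `f(v) ≥ 0` for all
`v ∈ V(G) − {v₀}`. (P2) For every non-empty set `A ⊆ V(G) − {v₀}`, there exists a vertex `v ∈ A`
such that `f(v) < outdeg_A(v)`. We say that a divisor `D ∈ Div(G)` is `v₀`-reduced if the map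
`v ↦ D(v)`, defined for `v ∈ V(G) − {v₀}`, is a `G`-parking function. In terms of the chip-firing
game, a divisor `D` is `v₀`-reduced if and only if (1) no vertex `v ≠ v₀` is in debt; and (2) for
every non-empty subset `A` of `V(G) − {v₀}`, if all vertices in `A` were to perform a lending
move, some vertex in `A` would go into debt. **Proposition 3.1.** Fix a base vertex `v₀ ∈ V(G)`.
Then for every `D ∈ Div(G)`, there exists a unique `v₀`-reduced divisor `D′ ∈ Div(G)` such that
`D′ ∼ D`. **Proof.** […] We need to show that any initial configuration can be transformed into a
configuration corresponding to a `v₀`-reduced divisor via a sequence of legal moves. To accomplish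
this, we first obtain a configuration where no vertex except `v₀` is in debt. […] If every vertex
of `A₁` can give a dollar to each of its neighbors outside `A₁` and remain out of debt, then each
vertex of `A₁` does so […] Note that `v₀` never lends money during this procedure, and so it must
stop receiving money at some point. […] the entire procedure has to stop. The configuration `D′`
obtained at the end of this process corresponds to a `v₀`-reduced divisor. […] For a vertex
`v ∈ V(G)`, let `d(v)` denote the length of the shortest path in `G` between `v` and `v₀`. […]
It remains to show that distinct `v₀`-reduced divisors cannot be equivalent. Suppose for the sake
of contradiction that we are given `v₀`-reduced divisors `D` and `D′` such that `D ∼ D′` and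
`D ≠ D′`. Let `f ∈ 𝓜(G)` be a function for which `D′ − D = Δ(f)`. Then `f` is non-constant, and
by symmetry we may assume that `f(v) > f(v₀)` for some `v ∈ V(G)`. Let `A` be the set of all the
vertices `v ∈ V(G)` for which `f(v)` is maximal. Then `v₀ ∉ A`, and for every `v ∈ A` we have
`0 ≤ D(v) = D′(v) − Σ_{e = vw ∈ E_v} (f(v) − f(w)) ≤ D′(v) − outdeg_A(v)`. Thus
`D′(v) ≥ outdeg_A(v)` for every `v ∈ A`, contradicting the assumption that `D′` is
`v₀`-reduced.»

## What is formalised (vocabulary of `GraphDivisors`: `LinEquiv`, `Winnable`; `Q = G.lapMatrix ℤ`;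
## `outdeg_A(v)` is written `#(G.neighborFinset v \ A)`; B–N's `Δ_v(f) = Σ_{e = wv}(f(v) − f(w))`
## is the lineage's `ChipFiring.lapMatrix_mulVec_apply_eq_sum_sub`, reused)

* `charFun A` (`χ_A`) and the set-lending move `D − Qχ_A`: `lapMatrix_mulVec_charFun_apply`,
  `sub_mulVec_charFun_apply_of_mem` («all vertices in `A` perform a lending move»: `v ∈ A` ends
  with `D(v) − outdeg_A(v)`), `sub_mulVec_charFun_apply_of_not_mem` (outside `A` nobody loses);
* **`IsReduced G q D`** — `D` is `q`-reduced, (P1) ∧ (P2) verbatim; `isReduced_iff`;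
* **Proposition 3.1, existence**: `exists_linEquiv_forall_ne_nonneg` («we first obtain a
  configuration where no vertex except `v₀` is in debt») and **`exists_isReduced`** (every `D` is
  linearly equivalent to a `q`-reduced divisor; `G` connected). B–N's termination («`v₀` never
  lends money […] the entire procedure has to stop», formalised by them with the distance `d(v)`
  to `v₀`) is run here with ONE distance-based potential: for `b(v) = n^{n − d(v)}` one has
  `(Qb)(v) < 0` for every `v ≠ v₀` (`lapMatrix_mulVec_distPow_neg`), so every non-trivial
  combination of lending moves avoiding `v₀` strictly increases `Φ(D) = Σ_v D(v) b(v)`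
  (`pot_lt_pot_sub_mulVec`), while `Φ` is bounded on the divisors of the class that are out of
  debt off `v₀` (`pot_le`); a maximiser is reduced;
* **Proposition 3.1, uniqueness**: `IsReduced.apply_le_apply_of_linEquiv` (B–N's maximum
  argument: if `D` is `q`-reduced and `D′ ∼ D` is out of debt off `q`, then `D′(q) ≤ D(q)` — the
  maximum of `f` is attained at `q`), **`IsReduced.eq_of_linEquiv`** («distinct `v₀`-reduced
  divisors cannot be equivalent»), **`existsUnique_isReduced`**, and the test
  **`IsReduced.winnable_iff`** (`|D| ≠ ∅` iff the `q`-reduced representative has `D(q) ≥ 0` —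
  the first half of the proof of Theorem 3.3: «If `D(v₀) ≥ 0` then we have `D ≥ 0`»).

Definitions with bodies and theorems; no `sorry`; no named facts.
-/

open Finset SimpleGraph Matrix
open Literature.Combinatorics.SimpleGraph.ChipFiring

namespace Literature.Combinatorics.SimpleGraph.BakerNorine

variable {V : Type*} [Fintype V] [DecidableEq V] (G : SimpleGraph V) [DecidableRel G.Adj]

/-! ### §1 Lending moves by a set of vertices: `D − Qχ_A` -/

section SetLending

omit [Fintype V] in
/-- «We denote by `χ_A : V(G) → {0,1}` the characteristic function of `A`» (as an integer vector).
[cite: BakerNorine2007, §1.2] -/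
def charFun (A : Finset V) : V → ℤ := fun v => if v ∈ A then 1 else 0

omit [Fintype V] in
/-- Unfolding `χ_A`. [cite: BakerNorine2007, §1.2] -/
theorem charFun_apply (A : Finset V) (v : V) : charFun A v = if v ∈ A then 1 else 0 := rfl

omit [Fintype V] in
/-- `χ_A ≥ 0`. [cite: BakerNorine2007, §1.2] -/
theorem charFun_nonneg (A : Finset V) : 0 ≤ charFun A := by
  intro v
  rw [charFun_apply]
  split_ifs <;> norm_num

/-- `Δ(χ_A)(v) = deg(v)χ_A(v) − |N(v) ∩ A|`. [cite: BakerNorine2007, §1.3 and §3.1] -/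
theorem lapMatrix_mulVec_charFun_apply (A : Finset V) (v : V) :
    (G.lapMatrix ℤ *ᵥ charFun A) v =
      (if v ∈ A then (G.degree v : ℤ) else 0) - #(G.neighborFinset v ∩ A) := by
  rw [SimpleGraph.lapMatrix_mulVec_apply]
  simp only [charFun_apply, mul_ite, mul_one, mul_zero, Finset.sum_boole, Finset.filter_mem_eq_inter]

/-- «If all vertices in `A` were to perform a lending move»: a vertex `v ∈ A` ends with
`D(v) − outdeg_A(v)` dollars. [cite: BakerNorine2007, §3.1 (and proof of Proposition 3.1:
«`D′(v) = D(v) − outdeg_A(v)`»)] -/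
theorem sub_mulVec_charFun_apply_of_mem (D : V → ℤ) {A : Finset V} {v : V} (hv : v ∈ A) :
    (D - G.lapMatrix ℤ *ᵥ charFun A) v = D v - #(G.neighborFinset v \ A) := by
  rw [Pi.sub_apply, lapMatrix_mulVec_charFun_apply, if_pos hv]
  have h := Finset.card_sdiff_add_card_inter (G.neighborFinset v) A
  rw [card_neighborFinset_eq_degree] at h
  omega

/-- Under the lending moves of `A`, a vertex outside `A` receives one dollar from each neighbour
in `A` («`D′(v) ≥ D(v)` for all `v ∈ V(G) − A`»). [cite: BakerNorine2007, Proposition 3.1 (proof)] -/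
theorem sub_mulVec_charFun_apply_of_not_mem (D : V → ℤ) {A : Finset V} {v : V} (hv : v ∉ A) :
    (D - G.lapMatrix ℤ *ᵥ charFun A) v = D v + #(G.neighborFinset v ∩ A) := by
  rw [Pi.sub_apply, lapMatrix_mulVec_charFun_apply, if_neg hv]
  ring

/-- Outside `A` nobody loses: «`D′(v) ≥ D(v)` for all `v ∈ V(G) − A`».
[cite: BakerNorine2007, Proposition 3.1 (proof)] -/
theorem le_sub_mulVec_charFun_apply_of_not_mem (D : V → ℤ) {A : Finset V} {v : V} (hv : v ∉ A) :
    D v ≤ (D - G.lapMatrix ℤ *ᵥ charFun A) v := by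
  rw [sub_mulVec_charFun_apply_of_not_mem G D hv]
  simp

end SetLending

/-! ### §2 `q`-reduced divisors (G-parking functions) -/

section Reduced

/-- **`D` is `q`-reduced** («the map `v ↦ D(v)`, defined for `v ∈ V(G) − {v₀}`, is a
`G`-parking function»): (P1) «`D(v) ≥ 0` for all `v ∈ V(G) − {v₀}`» and (P2) «for every
non-empty set `A ⊆ V(G) − {v₀}`, there exists a vertex `v ∈ A` such that `D(v) < outdeg_A(v)`»,
where `outdeg_A(v)` = «the number of edges of `G` having `v` as one endpoint and whose other
endpoint lies in `V(G) − A`» = `#(G.neighborFinset v \ A)`.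
[cite: BakerNorine2007, §3.1 (definition before Proposition 3.1)] -/
def IsReduced (q : V) (D : V → ℤ) : Prop :=
  (∀ v, v ≠ q → 0 ≤ D v) ∧
    ∀ A : Finset V, A.Nonempty → q ∉ A → ∃ v ∈ A, D v < #(G.neighborFinset v \ A)

/-- Unfolding `IsReduced`. [cite: BakerNorine2007, §3.1] -/
theorem isReduced_iff (q : V) (D : V → ℤ) : IsReduced G q D ↔
    (∀ v, v ≠ q → 0 ≤ D v) ∧
      ∀ A : Finset V, A.Nonempty → q ∉ A → ∃ v ∈ A, D v < #(G.neighborFinset v \ A) := Iff.rfl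

variable {G}

/-- (P1): a `q`-reduced divisor is out of debt away from `q`. [cite: BakerNorine2007, §3.1 (P1)] -/
theorem IsReduced.nonneg {q : V} {D : V → ℤ} (h : IsReduced G q D) {v : V} (hv : v ≠ q) : 0 ≤ D v :=
  h.1 v hv

/-- (P2) in chip-firing terms: for a `q`-reduced divisor, «if all vertices in `A` were to perform
a lending move, some vertex in `A` would go into debt». [cite: BakerNorine2007, §3.1 (2)] -/
theorem IsReduced.exists_sub_mulVec_charFun_neg {q : V} {D : V → ℤ} (h : IsReduced G q D)
    {A : Finset V} (hA : A.Nonempty) (hq : q ∉ A) :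
    ∃ v ∈ A, (D - G.lapMatrix ℤ *ᵥ charFun A) v < 0 := by
  obtain ⟨v, hv, hlt⟩ := h.2 A hA hq
  exact ⟨v, hv, by rw [sub_mulVec_charFun_apply_of_mem G D hv]; omega⟩

variable (G) in
/-- Conversely, (P1) together with «every non-empty `A ∌ q` lending puts some vertex of `A` into
debt» is `q`-reducedness. [cite: BakerNorine2007, §3.1 («if and only if (1) […] and (2) […]»)] -/
theorem isReduced_of_forall_exists_neg {q : V} {D : V → ℤ} (h1 : ∀ v, v ≠ q → 0 ≤ D v)
    (h2 : ∀ A : Finset V, A.Nonempty → q ∉ A → ∃ v ∈ A, (D - G.lapMatrix ℤ *ᵥ charFun A) v < 0) :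
    IsReduced G q D := by
  refine ⟨h1, fun A hA hq => ?_⟩
  obtain ⟨v, hv, hlt⟩ := h2 A hA hq
  exact ⟨v, hv, by rw [sub_mulVec_charFun_apply_of_mem G D hv] at hlt; omega⟩

end Reduced

/-! ### §3 A distance potential: `b(v) = n^{n − d(v)}` is strictly superharmonic off `q` -/

section Potential

variable {G}

omit [Fintype V] [DecidableEq V] [DecidableRel G.Adj] in
/-- Every vertex `v ≠ v₀` of a connected graph has «a neighbor `v′` of `v` such that
`d(v′) < d(v)`» (`d` = distance to `v₀`). [cite: BakerNorine2007, Proposition 3.1 (proof)] -/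
theorem exists_adj_dist_lt (hG : G.Connected) {q v : V} (hv : v ≠ q) :
    ∃ w, G.Adj v w ∧ G.dist w q < G.dist v q := by
  obtain ⟨p, hp⟩ := hG.exists_walk_length_eq_dist v q
  cases p with
  | nil => exact absurd rfl hv
  | cons h p' =>
    refine ⟨_, h, ?_⟩
    rw [SimpleGraph.Walk.length_cons] at hp
    have := SimpleGraph.dist_le p'
    omega

omit [DecidableEq V] [DecidableRel G.Adj] in
/-- `d(v) < n` (a shortest path has fewer than `n` edges). [folklore] -/
private theorem dist_lt_card (hG : G.Connected) (q v : V) : G.dist v q < Fintype.card V := by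
  obtain ⟨p, hp, hlen⟩ := hG.exists_path_of_dist v q
  rw [← hlen]
  exact hp.length_lt

variable (G) in
/-- The potential weights `b(v) = n^{n − d(v)}` (`n = |V|`, `d` = distance to `q`). [folklore] -/
private noncomputable def distPow (q : V) (v : V) : ℤ := (Fintype.card V : ℤ) ^ (Fintype.card V - G.dist v q)

omit [DecidableEq V] [DecidableRel G.Adj] in
/-- `b > 0`. [folklore] -/
private theorem distPow_pos (hG : G.Connected) (q v : V) : 0 < distPow G q v := by
  have : 0 < Fintype.card V := by
    have := hG.nonempty
    exact Fintype.card_pos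
  unfold distPow
  positivity

omit [DecidableEq V] [DecidableRel G.Adj] in
/-- `b` is largest at `q`. [folklore] -/
private theorem distPow_le_distPow_base (hG : G.Connected) (q v : V) : distPow G q v ≤ distPow G q q := by
  have hn : 0 < Fintype.card V := by
    have := hG.nonempty
    exact Fintype.card_pos
  unfold distPow
  rw [SimpleGraph.dist_self, Nat.sub_zero]
  exact pow_le_pow_right₀ (by exact_mod_cast hn) (Nat.sub_le _ _)

omit [DecidableEq V] [DecidableRel G.Adj] in
/-- A neighbour closer to `q` carries at least `n` times the weight. [folklore] -/
private theorem card_mul_distPow_le (hG : G.Connected) {q v w : V} (h : G.dist w q < G.dist v q) :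
    (Fintype.card V : ℤ) * distPow G q v ≤ distPow G q w := by
  have hn : 0 < Fintype.card V := by
    have := hG.nonempty
    exact Fintype.card_pos
  have hv := dist_lt_card hG q v
  unfold distPow
  rw [← pow_succ']
  exact pow_le_pow_right₀ (by exact_mod_cast hn) (by omega)

/-- **`(Qb)(v) < 0` for every `v ≠ q`**: the vertex `v` has a neighbour one step closer to `q`,
whose weight alone exceeds `deg(v) b(v)` («`v₀` never lends money […] and so it must stop
receiving money at some point. None of the neighbors of `v₀` lend money out from this point on
[…] Iterating this argument» — made quantitative). [cite: BakerNorine2007, Proposition 3.1 (proof)] -/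
private theorem lapMatrix_mulVec_distPow_neg (hG : G.Connected) {q v : V} (hv : v ≠ q) :
    (G.lapMatrix ℤ *ᵥ distPow G q) v < 0 := by
  obtain ⟨w, hvw, hw⟩ := exists_adj_dist_lt hG hv
  rw [SimpleGraph.lapMatrix_mulVec_apply, sub_neg]
  have h1 : distPow G q w ≤ ∑ u ∈ G.neighborFinset v, distPow G q u :=
    Finset.single_le_sum (fun u _ => (distPow_pos hG q u).le) ((mem_neighborFinset G v w).2 hvw)
  have h2 := card_mul_distPow_le hG hw
  have h3 : (G.degree v : ℤ) < Fintype.card V := by exact_mod_cast G.degree_lt_card_verts v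
  have h4 := distPow_pos hG q v
  nlinarith

variable (G) in
/-- The potential `Φ(D) = Σ_v D(v) b(v)`. [folklore] -/
private noncomputable def pot (q : V) (D : V → ℤ) : ℤ := ∑ v, D v * distPow G q v

/-- `Σ_v (Qx)(v) b(v) = Σ_v x(v) (Qb)(v)` («`Δ` is self-adjoint […] the bilinear pairing
`⟨f, D⟩ = Σ f(v)D(v)`»). [cite: BakerNorine2007, Remark 1.2] -/
private theorem sum_mulVec_mul_distPow (q : V) (x : V → ℤ) :
    ∑ v, (G.lapMatrix ℤ *ᵥ x) v * distPow G q v = ∑ v, x v * (G.lapMatrix ℤ *ᵥ distPow G q) v := by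
  have h1 : ∑ v, (G.lapMatrix ℤ *ᵥ x) v * distPow G q v = (G.lapMatrix ℤ *ᵥ x) ⬝ᵥ distPow G q := rfl
  have h2 : ∑ v, x v * (G.lapMatrix ℤ *ᵥ distPow G q) v = x ⬝ᵥ (G.lapMatrix ℤ *ᵥ distPow G q) := rfl
  rw [h1, h2, Matrix.dotProduct_mulVec, ← Matrix.mulVec_transpose,
    (SimpleGraph.isSymm_lapMatrix G (R := ℤ)).eq, dotProduct_comm]

/-- The lending moves of a non-zero `x ≥ 0` avoiding `q` strictly increase `Φ`.
[cite: BakerNorine2007, Proposition 3.1 (proof: «`μ₂(D′) > μ₂(D)`»)] -/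
private theorem pot_lt_pot_sub_mulVec (hG : G.Connected) {q : V} (D : V → ℤ) {x : V → ℤ}
    (hx : 0 ≤ x) (hxq : x q = 0) (hx0 : x ≠ 0) :
    pot G q D < pot G q (D - G.lapMatrix ℤ *ᵥ x) := by
  unfold pot
  simp only [Pi.sub_apply, sub_mul, Finset.sum_sub_distrib, sum_mulVec_mul_distPow]
  rw [lt_sub_comm, sub_self]
  -- `Σ_v x(v) (Qb)(v) < 0`: every term is `≤ 0`, and a vertex with `x(v) ≠ 0` gives `< 0`
  obtain ⟨u, hu⟩ : ∃ u, x u ≠ 0 := by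
    by_contra hcon
    push Not at hcon
    exact hx0 (funext hcon)
  have huq : u ≠ q := fun h => hu (h ▸ hxq)
  have hterm : ∀ v, x v * (G.lapMatrix ℤ *ᵥ distPow G q) v ≤ 0 := by
    intro v
    by_cases hvq : v = q
    · rw [hvq, hxq, zero_mul]
    · exact mul_nonpos_of_nonneg_of_nonpos (hx v) (lapMatrix_mulVec_distPow_neg hG hvq).le
  have hu_neg : x u * (G.lapMatrix ℤ *ᵥ distPow G q) u < 0 :=
    mul_neg_of_pos_of_neg (lt_of_le_of_ne (hx u) (Ne.symm hu)) (lapMatrix_mulVec_distPow_neg hG huq)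
  rw [← Finset.add_sum_erase _ _ (mem_univ u)]
  have := Finset.sum_nonpos (s := univ.erase u) fun v _ => hterm v
  omega

omit [DecidableRel G.Adj] in
/-- `Φ` is bounded above on the divisors that are out of debt away from `q`:
`Φ(D′) ≤ deg(D′)·b(q)`. [folklore] -/
private theorem pot_le (hG : G.Connected) {q : V} {D' : V → ℤ} (h : ∀ v, v ≠ q → 0 ≤ D' v) :
    pot G q D' ≤ (∑ v, D' v) * distPow G q q := by
  unfold pot
  rw [Finset.sum_mul]
  refine Finset.sum_le_sum fun v _ => ?_
  by_cases hvq : v = q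
  · rw [hvq]
  · exact mul_le_mul_of_nonneg_left (distPow_le_distPow_base hG q v) (h v hvq)

end Potential

/-! ### §4 Proposition 3.1: existence -/

section Existence

variable {G}

/-- **Proposition 3.1, first step**: «we first obtain a configuration where no vertex except
`v₀` is in debt» — every divisor on a connected graph is linearly equivalent to one that is out
of debt away from `q`. [cite: BakerNorine2007, Proposition 3.1 (proof)] -/
theorem exists_linEquiv_forall_ne_nonneg (hG : G.Connected) (q : V) (D : V → ℤ) :
    ∃ D' : V → ℤ, LinEquiv G D D' ∧ ∀ v, v ≠ q → 0 ≤ D' v := by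
  refine ⟨D - G.lapMatrix ℤ *ᵥ ((∑ u, |D u|) • distPow G q), linEquiv_sub_mulVec G D _,
    fun v hv => ?_⟩
  rw [Matrix.mulVec_smul, Pi.sub_apply, Pi.smul_apply, smul_eq_mul]
  have h1 : (G.lapMatrix ℤ *ᵥ distPow G q) v ≤ -1 := by
    have := lapMatrix_mulVec_distPow_neg hG hv
    omega
  have h2 : -D v ≤ ∑ u, |D u| :=
    (neg_le_abs (D v)).trans (Finset.single_le_sum (fun u _ => abs_nonneg (D u)) (mem_univ v))
  have h3 : 0 ≤ ∑ u, |D u| := Finset.sum_nonneg fun u _ => abs_nonneg (D u)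
  nlinarith

/-- **Proposition 3.1 (existence).** «For every `D ∈ Div(G)`, there exists a […] `v₀`-reduced
divisor `D′ ∈ Div(G)` such that `D′ ∼ D`» (`G` connected). Among the divisors of the class that
are out of debt off `q` take one maximising `Φ`; a non-empty `A ∌ q` all of whose vertices could
lend and stay out of debt would raise `Φ` («once again contradicting the choice of `D`»).
[cite: BakerNorine2007, Proposition 3.1] -/
theorem exists_isReduced (hG : G.Connected) (q : V) (D : V → ℤ) :
    ∃ D' : V → ℤ, LinEquiv G D D' ∧ IsReduced G q D' := by
  have hbdd : ∃ b : ℤ, ∀ z : ℤ,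
      (∃ D' : V → ℤ, (LinEquiv G D D' ∧ ∀ v, v ≠ q → 0 ≤ D' v) ∧ pot G q D' = z) → z ≤ b := by
    refine ⟨(∑ v, D v) * distPow G q q, ?_⟩
    rintro z ⟨D', ⟨hDD', hD'⟩, rfl⟩
    rw [hDD'.sum_eq]
    exact pot_le hG hD'
  have hinh : ∃ z : ℤ,
      ∃ D' : V → ℤ, (LinEquiv G D D' ∧ ∀ v, v ≠ q → 0 ≤ D' v) ∧ pot G q D' = z := by
    obtain ⟨D', hDD', hD'⟩ := exists_linEquiv_forall_ne_nonneg hG q D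
    exact ⟨_, D', ⟨hDD', hD'⟩, rfl⟩
  obtain ⟨z, ⟨D', ⟨hDD', hD'⟩, hz⟩, hmax⟩ := Int.exists_greatest_of_bdd hbdd hinh
  refine ⟨D', hDD', isReduced_of_forall_exists_neg G hD' fun A hA hqA => ?_⟩
  by_contra hcon
  push Not at hcon
  -- the lending moves of `A` keep everybody but `q` out of debt, and raise `Φ`
  have hD'' : ∀ v, v ≠ q → 0 ≤ (D' - G.lapMatrix ℤ *ᵥ charFun A) v := by
    intro v hv
    by_cases hvA : v ∈ A
    · exact hcon v hvA
    · exact (hD' v hv).trans (le_sub_mulVec_charFun_apply_of_not_mem G D' hvA)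
  have hne : charFun A ≠ 0 := by
    obtain ⟨a, ha⟩ := hA
    intro h0
    have := congrFun h0 a
    rw [charFun_apply, if_pos ha] at this
    exact one_ne_zero this
  have hlt := pot_lt_pot_sub_mulVec hG D' (charFun_nonneg A) (by rw [charFun_apply, if_neg hqA]) hne
  have := hmax _ ⟨_, ⟨hDD'.trans (linEquiv_sub_mulVec G D' _), hD''⟩, rfl⟩
  omega

end Existence

/-! ### §5 Proposition 3.1: uniqueness, and the test `|D| ≠ ∅ ⟺ D(q) ≥ 0` -/

section Uniqueness

variable {G}

/-- B–N's maximum argument: if `D` is `q`-reduced and `D − Δ(f)` is out of debt away from `q`,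
then `f` attains its maximum at `q` («Let `A` be the set of all the vertices `v ∈ V(G)` for which
`f(v)` is maximal. Then […] for every `v ∈ A` we have
`0 ≤ […] = D′(v) − Σ_{e = vw ∈ E_v} (f(v) − f(w)) ≤ D′(v) − outdeg_A(v)` […] contradicting the
assumption that `D′` is `v₀`-reduced»). [cite: BakerNorine2007, Proposition 3.1 (proof)] -/
theorem IsReduced.apply_le_apply_base {q : V} {D f : V → ℤ} (hD : IsReduced G q D)
    (hD' : ∀ v, v ≠ q → 0 ≤ (D - G.lapMatrix ℤ *ᵥ f) v) (w : V) : f w ≤ f q := by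
  obtain ⟨u, -, hu⟩ := Finset.exists_max_image univ f ⟨q, mem_univ q⟩
  suffices hq : f q = f u by rw [hq]; exact hu w (mem_univ w)
  by_contra hne
  set A := univ.filter (fun v => f v = f u) with hA
  have hAne : A.Nonempty := ⟨u, by simp [hA]⟩
  have hqA : q ∉ A := by simp [hA, hne]
  obtain ⟨v, hvA, hlt⟩ := hD.2 A hAne hqA
  have hfv : f v = f u := (Finset.mem_filter.1 hvA).2
  have hvq : v ≠ q := fun h => hqA (h ▸ hvA)
  have h0 := hD' v hvq
  rw [Pi.sub_apply, lapMatrix_mulVec_apply_eq_sum_sub] at h0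
  -- `Σ_{w ∼ v} (f(v) − f(w)) ≥ outdeg_A(v)`
  have hsum : (#(G.neighborFinset v \ A) : ℤ) ≤ ∑ w ∈ G.neighborFinset v, (f v - f w) := by
    calc (#(G.neighborFinset v \ A) : ℤ) = ∑ w ∈ G.neighborFinset v \ A, (1 : ℤ) := by simp
      _ ≤ ∑ w ∈ G.neighborFinset v \ A, (f v - f w) := Finset.sum_le_sum fun w hw => by
          have hwA : w ∉ A := (Finset.mem_sdiff.1 hw).2
          have hfw : f w ≠ f u := by simpa [hA] using hwA
          have h1 := hu w (mem_univ w)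
          omega
      _ ≤ ∑ w ∈ G.neighborFinset v, (f v - f w) :=
          Finset.sum_le_sum_of_subset_of_nonneg Finset.sdiff_subset fun w _ _ => by
            have h1 := hu w (mem_univ w)
            omega
  omega

/-- **The `q`-reduced divisor carries the most dollars at `q`**: if `D` is `q`-reduced, `D′ ∼ D`,
and `D′` is out of debt away from `q`, then `D′(q) ≤ D(q)`.
[cite: BakerNorine2007, Proposition 3.1 (proof)] -/
theorem IsReduced.apply_le_apply_of_linEquiv {q : V} {D D' : V → ℤ} (hD : IsReduced G q D)
    (h : LinEquiv G D D') (hD' : ∀ v, v ≠ q → 0 ≤ D' v) : D' q ≤ D q := by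
  obtain ⟨f, rfl⟩ := (linEquiv_iff_exists_eq_sub G D D').1 h
  have hmax := hD.apply_le_apply_base hD'
  rw [Pi.sub_apply, lapMatrix_mulVec_apply_eq_sum_sub, sub_le_self_iff]
  exact Finset.sum_nonneg fun w _ => by have := hmax w; omega

/-- **Proposition 3.1 (uniqueness).** «distinct `v₀`-reduced divisors cannot be equivalent»
(`f` is maximal at `v₀` and, by symmetry, minimal at `v₀`, hence constant).
[cite: BakerNorine2007, Proposition 3.1] -/
theorem IsReduced.eq_of_linEquiv {q : V} {D D' : V → ℤ} (hD : IsReduced G q D)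
    (hD' : IsReduced G q D') (h : LinEquiv G D D') : D = D' := by
  obtain ⟨f, rfl⟩ := (linEquiv_iff_exists_eq_sub G D D').1 h
  have h1 := hD.apply_le_apply_base (f := f) fun v hv => hD'.nonneg hv
  have h2 := hD'.apply_le_apply_base (f := -f) fun v hv => by
    rw [Matrix.mulVec_neg, sub_neg_eq_add, sub_add_cancel]
    exact hD.nonneg hv
  have hconst : ∀ v w, f v = f w := fun v w => by
    have := h1 v; have := h1 w; have := h2 v; have := h2 w
    simp only [Pi.neg_apply] at *
    omega
  rw [(lapMatrix_int_mulVec_eq_zero_iff G f).2 fun i j _ => hconst i j, sub_zero]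

/-- **Proposition 3.1.** «Fix a base vertex `v₀ ∈ V(G)`. Then for every `D ∈ Div(G)`, there
exists a unique `v₀`-reduced divisor `D′ ∈ Div(G)` such that `D′ ∼ D`» (`G` connected).
[cite: BakerNorine2007, Proposition 3.1] -/
theorem existsUnique_isReduced (hG : G.Connected) (q : V) (D : V → ℤ) :
    ∃! D' : V → ℤ, LinEquiv G D D' ∧ IsReduced G q D' := by
  obtain ⟨D', h, hD'⟩ := exists_isReduced hG q D
  exact ⟨D', ⟨h, hD'⟩, fun D'' hD'' => hD''.2.eq_of_linEquiv hD' (hD''.1.symm.trans h)⟩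

/-- **`|D| ≠ ∅` iff the `q`-reduced divisor of the class has `D(q) ≥ 0`** («If `D(v₀) ≥ 0`
then we have `D ≥ 0` and (N1) holds»; conversely an effective `E ∼ D` is out of debt off `q`, so
`0 ≤ E(q) ≤ D(q)`). [cite: BakerNorine2007, Theorem 3.3 (proof) with Proposition 3.1] -/
theorem IsReduced.winnable_iff {q : V} {D : V → ℤ} (hD : IsReduced G q D) :
    Winnable G D ↔ 0 ≤ D q := by
  constructor
  · rintro ⟨E, hE, hDE⟩
    exact (hE q).trans (hD.apply_le_apply_of_linEquiv hDE fun v _ => hE v)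
  · intro hq
    refine winnable_of_nonneg G fun v => ?_
    by_cases hv : v = q
    · rw [hv]
      exact hq
    · exact hD.nonneg hv

/-- `r(D) ≥ 0` iff the `q`-reduced divisor of the class has `D(q) ≥ 0`.
[cite: BakerNorine2007, Theorem 3.3 (proof) and Remark 1.10] -/
theorem IsReduced.rank_nonneg_iff [Nonempty V] {q : V} {D : V → ℤ} (hD : IsReduced G q D) :
    0 ≤ rank G D ↔ 0 ≤ D q := by
  rw [BakerNorine.rank_nonneg_iff G D, hD.winnable_iff]

/-- A `q`-reduced divisor in debt at `q` is in debt at `q` in every out-of-debt-off-`q` form: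
`|D| = ∅`. [cite: BakerNorine2007, Theorem 3.3 (proof)] -/
theorem IsReduced.not_winnable {q : V} {D : V → ℤ} (hD : IsReduced G q D) (hq : D q < 0) :
    ¬Winnable G D := fun h => by
  have := hD.winnable_iff.1 h
  omega

end Uniqueness

end Literature.Combinatorics.SimpleGraph.BakerNorine
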